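import Mathlib
import HarnessLib
import Summits.QuantumFields.YangMills.Theses.U1DipoleHelicity
import Summits.QuantumFields.YangMills.Theorems.U1DipoleHelicityAssembly
import Summits.QuantumFields.YangMills.Theorems.U1DipoleHelicityU1MeanPlaqToOneD4
import Summits.QuantumFields.YangMills.Theorems.U1DipoleHelicitySecondMomentUpper

/-!
# U1DipoleHelicity — the node `U1HelicityGapD4` from the dipole law and a ONE-SIDED second moment

Route `U1DipoleHelicity` (abelian COMPARISON line onto the node `Theorems.U1HelicityGapD4`; NOT a rung of
`YangMills`). The landed assembly (`assembly_proof`, `u1HelicityGapD4_of_parts`) consumes the crux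
`WilsonU1PlaquetteSecondMomentD4` (`|2β·G_μ(0;0,1) − 1| ≤ ε`) only through its UPPER half
`2β·G_μ(0;0,1) ≤ 1 + ε`: the charge identification bounds `β/β'` from ABOVE. This file records that
observation as theorems:

* `charge_ratio_le_of_upper` — `β|G(0) − K(0)/β'| ≤ ε`, `K(0) = 1/2`, `2βG(0) ≤ 1 + ε` ⇒ `β/β' ≤ 1 + 3ε`;
* `u1HelicityGapD4_of_parts_upper` — the one-sided twin of `u1HelicityGapD4_of_parts` (arbitrary kernel
  `K` with `K(0) = 1/2`; `ε = 1/40`, `δ = 1/5`);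
* `u1HelicityGapD4_of_dipoleLaw_of_secondMomentUpper` — with the two landed supports
  (`freeDipoleBoxMeanHalf_proof`, `u1MeanPlaqToOneD4_proof`) plugged in:
  (one-sided second moment) → `WilsonU1DipoleLawD4` → `U1HelicityGapD4`.

The one-sided second moment is the free-photon UPPER bound `limsup 2β⟨sin²θ_p⟩ ≤ 1`, which follows
from `sin² ≤ 2(1 − cos)` and the tree's equipartition `β⟨1 − cos θ_p⟩ → 1/4`
(`SoloBlind.weakCoupling_singlePlaquette`; being landed separately by the width seat as
`U1DipoleHelicitySecondMomentUpper`). With it, the node hinges on the single crux `WilsonU1DipoleLawD4`.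
Nothing here bears on the Yang–Mills mass gap.
-/

noncomputable section

open MeasureTheory Filter Topology Finset
open Literature.Probability.LatticeModels
open Literature.MathematicalPhysics.QuantumLattice
open Literature.MathematicalPhysics.QuantumFieldTheory hiding IsLocalObservable Site ZdEdge
open Summit.QuantumFields.YangMills.Theorems.U1Helicity

namespace Summit.QuantumFields.YangMills.Theorems.U1DipoleHelicity

variable {β : ℝ} {μ : Measure (LGConfig 4 Circle)}

/-- **One-sided charge identification.** From the dipole law at the origin, `β |G(0) − K(0)/β'| ≤ ε`
with `K(0) = 1/2`, and the UPPER second-moment bound `2βG(0) ≤ 1 + ε`, the renormalised coupling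
satisfies `β/β' ≤ 1 + 3ε` (for `β ≥ 0`). -/
theorem charge_ratio_le_of_upper {β β' ε g K0 : ℝ} (hβ : 0 ≤ β) (hK0 : K0 = 1 / 2)
    (hterm : β * |g - K0 / β'| ≤ ε) (hsec : 2 * β * g ≤ 1 + ε) :
    β / β' ≤ 1 + 3 * ε := by
  subst hK0
  have h := mul_le_mul_of_nonneg_left (neg_le_abs (g - 1 / 2 / β')) hβ
  have h' : β * -(g - 1 / 2 / β') = β / β' / 2 - β * g := by ring
  nlinarith [h, h', hterm, hsec]

/-- **The route's mechanism with a ONE-SIDED second moment**, for an arbitrary kernel `K` with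
`K(0) = 1/2`: the dipole law (`G = K/β' + R`, `βΣ|R| ≤ ε`), the upper bound `2βG(0) ≤ 1 + ε`, the
box-mean law (`Σ_{x,y∈B_N}K(x−y)/#B_N → 1/2`) and `⟨cos θ_p⟩ ≥ 1 − ε` give the helicity-gap inequality
with `δ = 1/5` (`ε = 1/40`). -/
theorem u1HelicityGapD4_of_parts_upper (K : Site 4 → ℝ) (hK0 : K 0 = 1 / 2)
    (hDip : ∀ ε : ℝ, 0 < ε → ∃ β₁ : ℝ, ∀ β : ℝ, β₁ < β →
      ∀ μ ∈ infiniteVolumeLimitPoints (d := 4) u1Rep β, ∃ β' : ℝ, 0 < β' ∧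
        Summable (fun z : Site 4 => |plaqCorr μ z 0 1 - K z / β'|) ∧
        β * ∑' z : Site 4, |plaqCorr μ z 0 1 - K z / β'| ≤ ε)
    (hSecU : ∀ ε : ℝ, 0 < ε → ∃ β₁ : ℝ, ∀ β : ℝ, β₁ < β →
      ∀ μ ∈ infiniteVolumeLimitPoints (d := 4) u1Rep β, 2 * β * plaqCorr μ 0 0 1 ≤ 1 + ε)
    (hBox : Filter.Tendsto (fun N : ℕ => (∑ x ∈ box 4 N, ∑ y ∈ box 4 N, K (x - y)) /
      ((box 4 N).card : ℝ)) Filter.atTop (nhds (1 / 2 : ℝ)))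
    (hMean : Summit.QuantumFields.YangMills.Theses.U1DipoleHelicity.U1MeanPlaqToOneD4) :
    ∃ β₁ : ℝ, ∀ β : ℝ, β₁ < β → ∀ μ ∈ infiniteVolumeLimitPoints (d := 4) u1Rep β,
      ∃ N₀ : ℕ, ∀ N : ℕ, N₀ ≤ N →
        β * ∫ U, (∑ x ∈ box 4 N, u1PlaqIm x 0 1 U) ^ 2 ∂μ ≤ (meanPlaq μ - 1 / 5) * #(box 4 N) := by
  obtain ⟨β₁, h₁⟩ := hDip (1 / 40) (by norm_num)
  obtain ⟨β₂, h₂⟩ := hSecU (1 / 40) (by norm_num)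
  obtain ⟨β₃, h₃⟩ := hMean (1 / 40) (by norm_num)
  have hev : ∀ᶠ N : ℕ in atTop, (∑ x ∈ box 4 N, ∑ y ∈ box 4 N, K (x - y)) / ((box 4 N).card : ℝ)
      ∈ Set.Icc (1 / 2 - 1 / 40 : ℝ) (1 / 2 + 1 / 40) :=
    hBox.eventually_mem (Icc_mem_nhds (by norm_num) (by norm_num))
  obtain ⟨N₀, hN₀⟩ := eventually_atTop.1 hev
  refine ⟨max (max β₁ β₂) (max β₃ 0), fun β hβ μ hμ => ?_⟩
  have hβ1 : β₁ < β := lt_of_le_of_lt (le_trans (le_max_left _ _) (le_max_left _ _)) hβ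
  have hβ2 : β₂ < β := lt_of_le_of_lt (le_trans (le_max_right _ _) (le_max_left _ _)) hβ
  have hβ3 : β₃ < β := lt_of_le_of_lt (le_trans (le_max_left _ _) (le_max_right _ _)) hβ
  have hβ0 : 0 ≤ β :=
    le_of_lt (lt_of_le_of_lt (le_trans (le_max_right _ _) (le_max_right _ _)) hβ)
  obtain ⟨β', hβ', hs, hR⟩ := h₁ β hβ1 μ hμ
  have hsec : 2 * β * plaqCorr μ 0 0 1 ≤ 1 + 1 / 40 := h₂ β hβ2 μ hμ
  have hmean : 1 - 1 / 40 ≤ meanPlaq μ := h₃ β hβ3 μ hμ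
  have hterm : β * |plaqCorr μ 0 0 1 - K 0 / β'| ≤ 1 / 40 := by
    refine le_trans (mul_le_mul_of_nonneg_left ?_ hβ0) hR
    exact hs.le_tsum (0 : Site 4) (fun z _ => abs_nonneg _)
  have hratio : β / β' ≤ 1 + 3 * (1 / 40) := charge_ratio_le_of_upper hβ0 hK0 hterm hsec
  refine ⟨N₀, fun N hN => ?_⟩
  have hbox := hN₀ N hN
  have hBpos : (0 : ℝ) < #(box 4 N) := by exact_mod_cast (box_nonempty 4 N).card_pos
  have hSKle : ∑ x ∈ box 4 N, ∑ y ∈ box 4 N, K (x - y) ≤ (1 / 2 + 1 / 40) * #(box 4 N) :=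
    (div_le_iff₀ hBpos).1 hbox.2
  have hSKge : (1 / 2 - 1 / 40) * #(box 4 N) ≤ ∑ x ∈ box 4 N, ∑ y ∈ box 4 N, K (x - y) :=
    (le_div_iff₀ hBpos).1 hbox.1
  have hSK0 : 0 ≤ ∑ x ∈ box 4 N, ∑ y ∈ box 4 N, K (x - y) :=
    le_trans (mul_nonneg (by norm_num) (Nat.cast_nonneg _)) hSKge
  have hmain := boxSecondMoment_le hμ hβ0 K hs hR N
  have hstep : β / β' * ∑ x ∈ box 4 N, ∑ y ∈ box 4 N, K (x - y)
      ≤ (1 + 3 * (1 / 40)) * ((1 / 2 + 1 / 40) * #(box 4 N)) :=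
    le_trans (mul_le_mul_of_nonneg_right hratio hSK0)
      (mul_le_mul_of_nonneg_left hSKle (by norm_num))
  have hfin : ((1 + 3 * (1 / 40)) * (1 / 2 + 1 / 40) + 1 / 40 : ℝ) * #(box 4 N)
      ≤ (meanPlaq μ - 1 / 5) * #(box 4 N) :=
    mul_le_mul_of_nonneg_right (by norm_num at hmean ⊢; linarith) (le_of_lt hBpos)
  linarith [hmain, hstep, hfin]

/-- **The node from the dipole law and a one-sided second moment.** With the two landed supports of
the route (`freeDipoleBoxMeanHalf_proof`: the box mean of the free kernel is `1/2`;
`u1MeanPlaqToOneD4_proof`: `⟨cos θ_p⟩ → 1`) and `K(0) = 1/2` (`freeDipole_zero`), the UPPER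
second-moment bound `2β·G_μ(0;0,1) ≤ 1 + ε` (eventually in `β`, uniformly over limit states) and the
crux `WilsonU1DipoleLawD4` imply the node `U1HelicityGapD4` (with `δ = 1/5`). -/
theorem u1HelicityGapD4_of_dipoleLaw_of_secondMomentUpper
    (hSecU : ∀ ε : ℝ, 0 < ε → ∃ β₁ : ℝ, ∀ β : ℝ, β₁ < β →
      ∀ μ ∈ infiniteVolumeLimitPoints (d := 4) u1Rep β, 2 * β * plaqCorr μ 0 0 1 ≤ 1 + ε)
    (hDip : Summit.QuantumFields.YangMills.Theses.U1DipoleHelicity.WilsonU1DipoleLawD4) :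
    Summit.QuantumFields.YangMills.Theorems.U1HelicityGapD4 := by
  obtain ⟨β₁, h⟩ := u1HelicityGapD4_of_parts_upper
    (fun z : Site 4 => (1 / (2 * Real.pi) ^ 4) *
      ∫ k in Set.pi Set.univ (fun _ : Fin 4 => Set.Icc (-Real.pi) Real.pi),
        Real.cos (∑ i : Fin 4, k i * (z i : ℝ)) *
          (((2 * Real.sin (k 0 / 2)) ^ 2 + (2 * Real.sin (k 1 / 2)) ^ 2) /
            (∑ i : Fin 4, (2 * Real.sin (k i / 2)) ^ 2)))
    freeDipole_zero hDip hSecU freeDipoleBoxMeanHalf_proof u1MeanPlaqToOneD4_proof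
  exact ⟨β₁, fun β hβ μ hμ => ⟨1 / 5, by norm_num, h β hβ μ hμ⟩⟩

/-- **The node from the dipole law ALONE.** With the width seat's free-photon upper bound
`wilsonU1PlaquetteSecondMoment_upper` (`2β·G_μ(0;0,1) ≤ 1 + ε` eventually, from `sin² ≤ 2(1 − cos)`
and the equipartition `β⟨1 − cos θ_p⟩ → 1/4`) plugged into
`u1HelicityGapD4_of_dipoleLaw_of_secondMomentUpper`: the crux `WilsonU1DipoleLawD4` implies the node
`U1HelicityGapD4` outright — the two-sided crux `WilsonU1PlaquetteSecondMomentD4` is not needed.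
(Route-level reading: LINE 4 hinges on the single crux stmt-QuantumFields-25880.) -/
theorem u1HelicityGapD4_of_wilsonU1DipoleLawD4
    (hDip : Summit.QuantumFields.YangMills.Theses.U1DipoleHelicity.WilsonU1DipoleLawD4) :
    Summit.QuantumFields.YangMills.Theorems.U1HelicityGapD4 :=
  u1HelicityGapD4_of_dipoleLaw_of_secondMomentUpper wilsonU1PlaquetteSecondMoment_upper hDip

/-- **Wilson-action `U(1)₄` masslessness from the dipole law alone**: `WilsonU1DipoleLawD4` implies
`Literature.Barriers.QuantumFields.AbelianMasslessPhaseD4` (no exponentially clustering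
infinite-volume limit state at large `β`), through the node and the tree reduction
`abelianMasslessPhaseD4_of_u1HelicityGapD4`. The dipole law itself (crux 25880) is open in print for
Wilson's action (Fröhlich–Spencer 1982, fn. 3); nothing non-abelian is claimed. -/
theorem abelianMasslessPhaseD4_of_wilsonU1DipoleLawD4
    (hDip : Summit.QuantumFields.YangMills.Theses.U1DipoleHelicity.WilsonU1DipoleLawD4) :
    Literature.Barriers.QuantumFields.AbelianMasslessPhaseD4 :=
  abelianMasslessPhaseD4_of_u1HelicityGapD4 (u1HelicityGapD4_of_wilsonU1DipoleLawD4 hDip)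

end Summit.QuantumFields.YangMills.Theorems.U1DipoleHelicity

end
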